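import Literature.Analysis.FunctionSpaces.Mollification
import HarnessLib

/-!
# Interior mollification of functions with a weak derivative on an open set

Local (interior) counterpart of the accepted whole-space file
`Literature/Analysis/FunctionSpaces/Mollification`, for an arbitrary additive Haar measure `μ`
on a finite-dimensional real inner product space `E` and an open set `U ⊆ E`
(Evans, *PDE*, §5.3.1, Theorem 1 "local approximation by smooth functions": for `u ∈ W^{k,p}(U)`
and `u^ε = η_ε ⋆ u` on `U_ε = {x ∈ U | dist(x, ∂U) > ε}` one has `Dᵅ u^ε = η_ε ⋆ Dᵅ u` in
`U_ε`). Let `f : E → F` (real Banach space `F`) have the weak derivative `g` on `U`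
(accepted `Literature.HasWeakFDerivOn U μ f g`) with `f`, `g` integrable on `U`, extend both by zero
(`𝟙_U f`, `𝟙_U g`), and let `φ` be a bump function centred at `0` with normalisation
`φ.normed μ` (`∫ φ.normed μ ∂μ = 1`). Then

* `Literature.Analysis.FunctionSpaces.isTestFunctionOn_normed_comp_sub`: `y ↦ φ.normed μ (x - y)` is a test function on `U`
  as soon as `closedBall x φ.rOut ⊆ U`;
* `Literature.Analysis.FunctionSpaces.HasWeakFDerivOn.hasFDerivAt_normed_convolution_indicator`: at such points `x` the
  mollification `φ.normed μ ⋆ 𝟙_U f` has Fréchet derivative `(φ.normed μ ⋆ 𝟙_U g)(x)`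
  (Evans, §5.3.1, Thm. 1, proof, step 1);
* `Literature.Analysis.FunctionSpaces.HasWeakFDerivOn.eLpNorm_fderiv_normed_convolution_indicator_le`: on every measurable
  set `S` all of whose points satisfy `closedBall x φ.rOut ⊆ U`,
  `‖D(φ.normed μ ⋆ 𝟙_U f)‖_{L^p(S)} ≤ ‖g‖_{L^p(U)}` for `1 ≤ p ≤ ∞` (Young's inequality with a
  unit-mass kernel, accepted `Literature.Analysis.UnboundedOperators.eLpNorm_convolution_le_lintegral_enorm_mul`).

## References

* L. C. Evans, *Partial Differential Equations*, 2nd ed. (AMS 2010), §5.3.1, Theorem 1, and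
  App. C.4, Theorem 7.
* R. A. Adams, J. J. F. Fournier, *Sobolev Spaces*, 2nd ed. (2003), Lemma 3.16.
-/

noncomputable section

open MeasureTheory TopologicalSpace Set Function Filter Topology ContinuousLinearMap Metric
open scoped ENNReal NNReal Convolution ContDiff

namespace Literature.Analysis.FunctionSpaces

variable {E : Type*} [NormedAddCommGroup E] [InnerProductSpace ℝ E] [FiniteDimensional ℝ E]
  [MeasurableSpace E] [BorelSpace E] {μ : Measure E} [μ.IsAddHaarMeasure]
variable {F : Type*} [NormedAddCommGroup F] [NormedSpace ℝ F]

/-! ### Reflected translates of normalised bumps are test functions in the interior -/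

/-- If `closedBall x φ.rOut ⊆ U` then `y ↦ φ.normed μ (x - y)` is a test function on `U`: it is
smooth, and its topological support is `closedBall x φ.rOut`
(Evans, *PDE*, App. C.4: `η_ε(x - ·)` is supported in `B(x, ε) ⊆ U` for `x ∈ U_ε`). [folklore] -/
theorem isTestFunctionOn_normed_comp_sub {U : Opens E} (φ : ContDiffBump (0 : E)) {x : E}
    (hx : closedBall x φ.rOut ⊆ U) :
    IsTestFunctionOn U fun y => φ.normed μ (x - y) where
  contDiff := φ.contDiff_normed.comp (contDiff_const.sub contDiff_id)
  hasCompactSupport := φ.hasCompactSupport_normed.comp_homeomorph (Homeomorph.subLeft x)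
  tsupport_subset := by
    refine Subset.trans ?_ hx
    refine closure_minimal ?_ isClosed_closedBall
    intro y hy
    have hy' : x - y ∈ Function.support (φ.normed μ) := hy
    rw [φ.support_normed_eq, mem_ball, dist_zero_right] at hy'
    rw [mem_closedBall, dist_comm, dist_eq_norm]
    exact hy'.le

/-- The normalised bump kernel has unit mass in `ℝ≥0∞`: `∫⁻ ‖φ.normed μ‖ₑ ∂μ = 1`
(Evans, *PDE*, App. C.4, `∫ η_ε = 1`); version of the accepted `Literature.Analysis.FunctionSpaces.lintegral_enorm_normed`
for an arbitrary additive Haar measure. [folklore] -/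
theorem lintegral_enorm_normed' (φ : ContDiffBump (0 : E)) :
    ∫⁻ y, ‖φ.normed μ y‖ₑ ∂μ = 1 := by
  have h : ∀ y, ‖φ.normed μ y‖ₑ = ENNReal.ofReal (φ.normed μ y) := fun y =>
    Real.enorm_eq_ofReal (φ.nonneg_normed y)
  simp_rw [h]
  rw [← ofReal_integral_eq_lintegral_ofReal φ.integrable_normed
    (Eventually.of_forall φ.nonneg_normed), φ.integral_normed, ENNReal.ofReal_one]

/-! ### Mollification commutes with weak differentiation in the interior -/

section WeakDeriv

variable {U : Opens E} {f : E → F} {g : E → E →L[ℝ] F}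

/-- The weak-derivative identity tested against `φ.normed μ (x - ·)` for `closedBall x φ.rOut ⊆ U`:
`∫_U D(φ.normed μ)(x - y) v • f y = ∫_U φ.normed μ (x - y) • g y v` (Evans, *PDE*, §5.3.1,
proof of Thm. 1: the two minus signs cancel). [folklore] -/
theorem HasWeakFDerivOn.setIntegral_fderiv_normed_comp_sub_smul (hw : HasWeakFDerivOn U μ f g)
    (φ : ContDiffBump (0 : E)) {x : E} (hx : closedBall x φ.rOut ⊆ U) (v : E) :
    ∫ y in (U : Set E), (fderiv ℝ (φ.normed μ) (x - y) v) • f y ∂μ =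
      ∫ y in (U : Set E), φ.normed μ (x - y) • g y v ∂μ := by
  have key := hw.integral_fderiv_smul_eq (fun y => φ.normed μ (x - y)) v
    (isTestFunctionOn_normed_comp_sub φ hx)
  have hφ1 : ContDiff ℝ 1 (φ.normed μ) := φ.contDiff_normed
  simp only [fderiv_comp_sub_left_apply hφ1, neg_smul, integral_neg, neg_inj] at key
  exact key

/-- **Interior mollification commutes with weak differentiation** (Evans, *PDE*, §5.3.1,
Theorem 1, step 1 of the proof: `Dᵅ u^ε = η_ε ⋆ Dᵅ u` on `U_ε`; Adams–Fournier, Lemma 3.16).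
If `g` is a weak derivative of `f` on `U`, `f` and `g` are integrable on `U`, and
`closedBall x φ.rOut ⊆ U`, then the mollification of the zero extension `𝟙_U f` has Fréchet
derivative `∫_U φ.normed μ (x - y) • g y dy` at `x`. Proof: Mathlib's
`HasCompactSupport.hasFDerivAt_convolution_left` gives the derivative `(Dφ.normed μ) ⋆ 𝟙_U f`,
and the weak-derivative identity against the test function `φ.normed μ (x - ·)`
(`setIntegral_fderiv_normed_comp_sub_smul`) identifies it with `∫_U φ.normed μ (x - y) • g y dy`.
[cite: Evans2010, §5.3.1 Theorem 1] -/
theorem HasWeakFDerivOn.hasFDerivAt_normed_convolution_indicator (hw : HasWeakFDerivOn U μ f g)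
    (hf : IntegrableOn f U μ) (hg : IntegrableOn g U μ) (φ : ContDiffBump (0 : E)) {x : E}
    (hx : closedBall x φ.rOut ⊆ U) :
    HasFDerivAt (φ.normed μ ⋆[lsmul ℝ ℝ, μ] (U : Set E).indicator f)
      (∫ y in (U : Set E), φ.normed μ (x - y) • g y ∂μ) x := by
  have hUm : MeasurableSet (U : Set E) := U.isOpen.measurableSet
  have hfi : LocallyIntegrable ((U : Set E).indicator f) μ :=
    (hf.integrable_indicator hUm).locallyIntegrable
  have hφ1 : ContDiff ℝ 1 (φ.normed μ) := φ.contDiff_normed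
  have hφc : HasCompactSupport (φ.normed μ) := φ.hasCompactSupport_normed
  have hD := hφc.hasFDerivAt_convolution_left (lsmul ℝ ℝ) hφ1 hfi x
  suffices heq : (fderiv ℝ (φ.normed μ) ⋆[(lsmul ℝ ℝ : ℝ →L[ℝ] F →L[ℝ] F).precompL E, μ]
      (U : Set E).indicator f) x = ∫ y in (U : Set E), φ.normed μ (x - y) • g y ∂μ by
    rwa [heq] at hD
  have hint : ConvolutionExistsAt (fderiv ℝ (φ.normed μ)) ((U : Set E).indicator f) x
      ((lsmul ℝ ℝ : ℝ →L[ℝ] F →L[ℝ] F).precompL E) μ :=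
    (hφc.fderiv ℝ).convolutionExists_left _ (hφ1.continuous_fderiv one_ne_zero) hfi x
  -- the integrand `φ.normed μ (x - y) • g y` is integrable on `U` (bounded times integrable)
  have hψ := isTestFunctionOn_normed_comp_sub (μ := μ) φ hx
  obtain ⟨C, hC⟩ := hψ.contDiff.continuous.bounded_above_of_compact_support hψ.hasCompactSupport
  have hint' : Integrable (fun y => φ.normed μ (x - y) • g y) (μ.restrict U) := by
    have := hg.bdd_smul C (hψ.contDiff.continuous.aestronglyMeasurable) (ae_of_all _ hC)
    exact this
  ext v
  rw [convolution_def, ContinuousLinearMap.integral_apply hint.integrable v,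
    ContinuousLinearMap.integral_apply hint' v]
  simp only [precompL_apply, lsmul_apply, _root_.FunLike.coe_smul, Pi.smul_apply]
  have h1 : ∫ t, (fderiv ℝ (φ.normed μ) t v) • (U : Set E).indicator f (x - t) ∂μ =
      ∫ y in (U : Set E), (fderiv ℝ (φ.normed μ) (x - y) v) • f y ∂μ := by
    rw [← integral_sub_left_eq_self
      (fun t => (fderiv ℝ (φ.normed μ) t v) • (U : Set E).indicator f (x - t)) μ x,
      ← integral_indicator hUm]
    congr 1 with y
    simp only [sub_sub_cancel, Set.indicator_smul_apply]
  rw [h1]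
  exact hw.setIntegral_fderiv_normed_comp_sub_smul φ hx v

/-- Pointwise bound for the derivative of an interior mollification:
`‖D(φ.normed μ ⋆ 𝟙_U f)(x)‖ ≤ (φ.normed μ ⋆ 𝟙_U ‖g‖)(x) = ∫ φ.normed μ (x - y) 𝟙_U(y) ‖g y‖ dy`
when `closedBall x φ.rOut ⊆ U` (Evans, *PDE*, §5.3.1, proof of Thm. 1). [folklore] -/
theorem HasWeakFDerivOn.norm_fderiv_normed_convolution_indicator_le
    (hw : HasWeakFDerivOn U μ f g) (hf : IntegrableOn f U μ) (hg : IntegrableOn g U μ)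
    (φ : ContDiffBump (0 : E)) {x : E} (hx : closedBall x φ.rOut ⊆ U) :
    ‖fderiv ℝ (φ.normed μ ⋆[lsmul ℝ ℝ, μ] (U : Set E).indicator f) x‖ ≤
      (φ.normed μ ⋆[lsmul ℝ ℝ, μ] (U : Set E).indicator fun y => ‖g y‖) x := by
  have hUm : MeasurableSet (U : Set E) := U.isOpen.measurableSet
  rw [(hw.hasFDerivAt_normed_convolution_indicator hf hg φ hx).fderiv, convolution_def]
  simp only [lsmul_apply, smul_eq_mul]
  calc ‖∫ y in (U : Set E), φ.normed μ (x - y) • g y ∂μ‖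
      ≤ ∫ y in (U : Set E), ‖φ.normed μ (x - y) • g y‖ ∂μ := norm_integral_le_integral_norm _
    _ = ∫ y in (U : Set E), φ.normed μ (x - y) * ‖g y‖ ∂μ := by
        congr 1 with y
        rw [norm_smul, Real.norm_of_nonneg (φ.nonneg_normed _)]
    _ = ∫ y, φ.normed μ (x - y) * (U : Set E).indicator (fun y => ‖g y‖) y ∂μ := by
        rw [← integral_indicator hUm]
        congr 1 with y
        by_cases hy : y ∈ (U : Set E)
        · simp only [Set.indicator_of_mem hy]
        · simp only [Set.indicator_of_notMem hy, mul_zero]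
    _ = ∫ t, φ.normed μ t * (U : Set E).indicator (fun y => ‖g y‖) (x - t) ∂μ := by
        rw [← integral_sub_left_eq_self
          (fun t => φ.normed μ t * (U : Set E).indicator (fun y => ‖g y‖) (x - t)) μ x]
        simp only [sub_sub_cancel]

/-- **`L^p` control of the derivative of interior mollifications** (Evans, *PDE*, §5.3.1,
Thm. 1 with App. C.4, Thm. 7: `‖η_ε ⋆ Du‖_{L^p(U_ε)} ≤ ‖Du‖_{L^p(U)}`). If `g` is a weak
derivative of `f` on `U`, `f`, `g` are integrable on `U`, `1 ≤ p ≤ ∞`, and `S` is a measurable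
set with `closedBall x φ.rOut ⊆ U` for all `x ∈ S`, then
`‖D(φ.normed μ ⋆ 𝟙_U f)‖_{L^p(S, μ)} ≤ ‖g‖_{L^p(U, μ)}`: on `S` the derivative is bounded
pointwise by `φ.normed μ ⋆ 𝟙_U ‖g‖` (`norm_fderiv_normed_convolution_indicator_le`), whose
`L^p(μ)` norm is at most `(∫ φ.normed μ) ‖𝟙_U g‖_{L^p} = ‖g‖_{L^p(U)}` by Young's inequality
(accepted `Literature.Analysis.UnboundedOperators.eLpNorm_convolution_le_lintegral_enorm_mul`). [cite: Evans2010, §5.3.1 Theorem 1] -/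
theorem HasWeakFDerivOn.eLpNorm_fderiv_normed_convolution_indicator_le
    (hw : HasWeakFDerivOn U μ f g) (hf : IntegrableOn f U μ) (hg : IntegrableOn g U μ)
    (φ : ContDiffBump (0 : E)) {S : Set E} (hS : MeasurableSet S)
    (hSU : ∀ x ∈ S, closedBall x φ.rOut ⊆ U) {p : ℝ≥0∞} (hp : 1 ≤ p) :
    eLpNorm (fderiv ℝ (φ.normed μ ⋆[lsmul ℝ ℝ, μ] (U : Set E).indicator f)) p (μ.restrict S) ≤
      eLpNorm g p (μ.restrict (U : Set E)) := by
  have hUm : MeasurableSet (U : Set E) := U.isOpen.measurableSet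
  have hgm : AEStronglyMeasurable ((U : Set E).indicator fun y => ‖g y‖) μ :=
    (aestronglyMeasurable_indicator_iff hUm).2 hg.aestronglyMeasurable.norm
  calc eLpNorm (fderiv ℝ (φ.normed μ ⋆[lsmul ℝ ℝ, μ] (U : Set E).indicator f)) p (μ.restrict S)
      ≤ eLpNorm (φ.normed μ ⋆[lsmul ℝ ℝ, μ] (U : Set E).indicator fun y => ‖g y‖) p
          (μ.restrict S) := by
        refine eLpNorm_mono_ae_real ?_
        filter_upwards [ae_restrict_mem hS] with x hx
        exact hw.norm_fderiv_normed_convolution_indicator_le hf hg φ (hSU x hx)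
    _ ≤ eLpNorm (φ.normed μ ⋆[lsmul ℝ ℝ, μ] (U : Set E).indicator fun y => ‖g y‖) p μ :=
        eLpNorm_mono_measure _ Measure.restrict_le_self
    _ ≤ (∫⁻ y, ‖φ.normed μ y‖ₑ ∂μ) * eLpNorm ((U : Set E).indicator fun y => ‖g y‖) p μ :=
        UnboundedOperators.eLpNorm_convolution_le_lintegral_enorm_mul
          (φ.contDiff_normed (n := 1)).continuous.aestronglyMeasurable hgm hp
    _ = eLpNorm g p (μ.restrict (U : Set E)) := by
        rw [lintegral_enorm_normed', one_mul, eLpNorm_indicator_eq_eLpNorm_restrict hUm,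
          eLpNorm_norm]

end WeakDeriv

end Literature.Analysis.FunctionSpaces
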